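import Literature.Analysis.FluidPDE.Seregin2024AxisymTypeIIScenario
import Literature.Analysis.FluidPDE.Seregin2023.PolynomialScenarioExcluded
import Literature.Analysis.FluidPDE.Seregin2020AncientLimit
import HarnessLib

/-!
# Seregin 2024, Prop. 2.3 / Cor. 2.4 (axisymmetric Type II power-concentration scenario) FOLLOW
# from Seregin 2026, Thm 2.1 — the two named facts reduced to one

Analysis/FluidPDE support file (all results proved; no new named fact). Cell `pub/ns-blowup`,
HARVEST-MAP ruling C24. The tree carries, IN PARALLEL, two renderings of G. Seregin's note
*A note on potential Type II blowups of axisymmetric solutions to the Navier–Stokes equations*,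
arXiv:2402.13229 [`Seregin2024AxisymTypeII`]:

* the named facts `seregin2024_axisym_typeII_scenario_excluded_Lq` (Prop. 2.3) and
  `seregin2024_axisym_typeII_scenario_excluded_vorticity` (Cor. 2.4)
  (`Seregin2024AxisymTypeIIScenario.lean`), stated over Seregin–Šverák's coordinate cylinders
  `Q = 𝒞 × ]-1,0[` with ALL standing hypotheses of §§1–2 (`Seregin2024ScenarioHypotheses`:
  axisymmetric suitable weak pair, (1.13), (1.4), (1.5), (2.1), (2.2), the restriction on `m`,
  (1.3), the origin a Type II point) plus the integrability (2.3) resp. its vorticity form, with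
  conclusion `M^{3,3}_{2,m₀}(v, r) → 0` (`m₀ = 2m/(3-m)`), and
* the verdict theorems of `Seregin2023/PolynomialScenarioExcluded.lean`: GIVEN the later
  G. Seregin, *Remarks on Type II blowups of solutions to the Navier–Stokes equations*
  [`Seregin2026`], Thm 2.1 (the named fact `Seregin2023.seregin2026_typeII_scenario_excluded`),
  the bound (1.3) ALONE forces `r^{-2m₀} ∫_{Q(r)} |v|³ → 0` for every suitable weak pair in the
  unit parabolic BALL `Q(0,1) = B(1) × ]-1,0[`, no symmetry, all `0 < m < 1`
  (`Seregin2023.seregin2026_typeII_scenario_excluded.tendsto_cubic_seregin2025`).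

This file proves that the second implies the first, i.e. that both Seregin-2024 facts are
consequences of the single Seregin-2026 fact (debt accounting: cite
`(h : Seregin2023.seregin2026_typeII_scenario_excluded)` and the reductions below instead of the
two `seregin2024_…` facts). The class bookkeeping is:

1. `Q(0,1) ⊆ 𝒞 × ]-1,0[` (`parabolicCylinder_subset_parCyl`, `B(R) ⊆ 𝒞(R)`), so the cylinder
   classes of `Seregin2024ScenarioHypotheses` restrict to Albritton–Barker's ball class
   `IsSuitableWeakSolutionInBall 1 0 v q` — this is the tree's
   `Seregin2020.isSuitableWeakSolutionInBall_one` — and the weak gradient restricts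
   (`HasWeakSpatialGradientOn.mono`);
2. (1.3) over the cylinders `𝒞(R) × ]-R²,0[`, `0 < R ≤ 1`, with the weights `R^{-(2m-1)}`,
   `R^{-2m}`, `R^{-m}`, dominates Seregin 2026's (1.7) `A_f + E_f + D_f ≤ M₁` over the balls with
   `f(r) = r^{1-m}` (`Seregin2023.rpow_one_sub_weights`: `f²/r = r^{-(2m-1)}`, `f/r = r^{-m}`,
   `f²/r² = r^{-2m}`), with `M₁ = 3c`; the `sup_t` of (1.3), imposed at every `t`, bounds the
   essential supremum in `A_f`;
3. `M^{3,3}_{2m₀}(v, r) = r^{-2m₀} ∫_{-r²}^0 (∫_{B(r)} |v|³)^{3/3} = r^{-2m₀} ∫_{Q(r)} |v|³` (Tonelli,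
   `Seregin2023.lintegral_parabolicCylinder_enorm_pow_three`; measurability of `v` on `Q(r) ⊆ Q(1)`
   from the weak gradient's local integrability), for `0 < r < 1` — an eventual equality along
   `𝓝[>] 0`.

Consequently the hypotheses (2.3) / its vorticity form, (1.5), (2.1), (2.2), `l₁ ≤ s₁`,
`m < (4l₁-3)/(l₁+1)`, the axial symmetry and the Type II hypothesis of Prop. 2.3 / Cor. 2.4 are
not used: `Seregin2024ScenarioHypotheses.tendsto_morreyM_of_seregin2026` needs of them only the
class, `1/2 ≤ m < 1` and (1.3).

## What this is NOT

Not a discharge: every theorem here is conditional on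
`(h : Seregin2023.seregin2026_typeII_scenario_excluded)` ([Seregin2026] Thm 2.1, a typed,
unasserted printed statement). Nothing here asserts anything about Navier–Stokes regularity or
blow-up; the Seregin-2024 scenario is shown EMPTY MODULO [Seregin2026] Thm 2.1, exactly as the
verdict theorems of `PolynomialScenarioExcluded.lean` already say for the ball class.

## References

* G. Seregin, arXiv:2402.13229 (2024): §1 (1.2)–(1.3) (p. 2–4), §2 Prop. 2.3, Cor. 2.4 (p. 7).
  [`Seregin2024AxisymTypeII`]
* G. Seregin, *Remarks on Type II blowups …* (2026): (1.4), (1.7) (pp. 3–4), Thm 2.1 (p. 5).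
  [`Seregin2026`]
* G. Seregin, arXiv:2507.08733 (2025), Thm 1.1 (1.1) ⇒ (1.6) (p. 2). [`Seregin2025TypeIIScenario`]
* G. Seregin, Anal. Math. Phys. 10 (2020) no. 46, Def. 1.3 (the cylinder classes).
  [`Seregin2020`]
-/

noncomputable section

open MeasureTheory Set Filter Metric Function TopologicalSpace
open _root_.Topology
open scoped ENNReal NNReal

namespace Literature.Analysis.FluidPDE

namespace Seregin2023

/-- **`M^{3,3}_{2m₀}(v, r) = r^{-2m₀} ∫_{Q(z,r)} |v|³ dz`** for `r > 0` and `v` measurable on the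
parabolic ball `Q(z,r)`: at `s = l = 3` the scenario quantity
`M^{s,l}_κ(v,r) = r^{-κ} ∫ (∫_{B(r)} |v|^s)^{l/s}` of [Seregin2026] (display after (1.3)), taken with
`κ = 2m₀`, is the quantity `M^{3,3}_{2,m₀}(v,r)` of [Seregin2024AxisymTypeII] (1.2) (Tonelli,
`lintegral_parabolicCylinder_enorm_pow_three`). [cite: Seregin2024AxisymTypeII, (1.2) (arXiv:2402.13229 p. 2); Seregin2026, §1 p. 3 (display after (1.3))] -/
theorem morreyM_two_mul_three_three_eq
    {v : ℝ → EuclideanSpace ℝ (Fin 3) → EuclideanSpace ℝ (Fin 3)}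
    {z : ℝ × EuclideanSpace ℝ (Fin 3)} {r : ℝ} (m₀ : ℝ)
    (hmeas : AEStronglyMeasurable (uncurry v) (volume.restrict (parabolicCylinder r z))) :
    morreyM (2 * m₀) 3 3 z v r =
      ENNReal.ofReal (r ^ (-(2 * m₀))) *
        ∫⁻ w in parabolicCylinder r z, ‖v w.1 w.2‖ₑ ^ (3 : ℕ) := by
  rw [lintegral_parabolicCylinder_enorm_pow_three hmeas]
  simp only [morreyM]
  have h1 : ∀ t, (∫⁻ x in ball z.2 r, ‖v t x‖ₑ ^ (3 : ℝ)) ^ ((3 : ℝ) / 3) =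
      ∫⁻ x in ball z.2 r, ‖v t x‖ₑ ^ (3 : ℝ) := by
    intro t
    rw [div_self (by norm_num : (3 : ℝ) ≠ 0), ENNReal.rpow_one]
  simp_rw [h1]

end Seregin2023

namespace Seregin2024ScenarioHypotheses

variable {v : ℝ → EuclideanSpace ℝ (Fin 3) → EuclideanSpace ℝ (Fin 3)}
  {q : ℝ → EuclideanSpace ℝ (Fin 3) → ℝ}
  {G : ℝ → EuclideanSpace ℝ (Fin 3) → EuclideanSpace ℝ (Fin 3) →L[ℝ] EuclideanSpace ℝ (Fin 3)}
  {H : ℝ → EuclideanSpace ℝ (Fin 3) →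
    EuclideanSpace ℝ (Fin 3) →L[ℝ] EuclideanSpace ℝ (Fin 3) →L[ℝ] EuclideanSpace ℝ (Fin 3)}
  {W : ℝ → EuclideanSpace ℝ (Fin 3) → EuclideanSpace ℝ (Fin 3)}
  {m s₁ l₁ c : ℝ}

/-- The unit parabolic ball `Q(0,1) = ]-1,0[ × B(1)` lies in Seregin–Šverák's unit cylinder
`Q = 𝒞 × ]-1,0[` ("we replace all spatial balls `B(a)` with cylinders `𝒞(a)`", §2), as an
inequality of `Opens`. [cite: Seregin2024AxisymTypeII, §2 p. 5 (balls replaced by cylinders)] -/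
theorem parabolicCylinderOpens_one_le_parCylOpens :
    parabolicCylinderOpens 1 (0 : ℝ × EuclideanSpace ℝ (Fin 3)) ≤
      SereginSverak2009.parCylOpens 0 1 := by
  intro w hw
  have hQ : parabolicCylinder 1 (0 : ℝ × EuclideanSpace ℝ (Fin 3)) ⊆
      ((SereginSverak2009.parCylOpens 0 1 : Opens (ℝ × EuclideanSpace ℝ (Fin 3))) :
        Set (ℝ × EuclideanSpace ℝ (Fin 3))) := by
    rw [SereginSverak2009.coe_parCylOpens]
    exact parabolicCylinder_subset_parCyl 0 1
  exact hQ hw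

/-- **The cylinder classes restrict to Albritton–Barker's ball class.** Under the standing
hypotheses of [Seregin2024AxisymTypeII] §§1–2 the pair `(v, q)` is a suitable weak solution in the
unit parabolic ball `Q(0,1) ⊆ 𝒞 × ]-1,0[` in the class of `IsSuitableWeakSolutionInBall 1 0`
(the tree's `Seregin2020.isSuitableWeakSolutionInBall_one`, `B(R) ⊆ 𝒞(R)`).
[cite: Seregin2024AxisymTypeII, §1 p. 3 (suitable weak solutions in Q) and §2 p. 5] -/
theorem isSuitableWeakSolutionInBall (hyp : Seregin2024ScenarioHypotheses v q G H W m s₁ l₁ c) :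
    IsSuitableWeakSolutionInBall 1 0 v q := by
  obtain ⟨hsw, hA, hG, hE, hq, -⟩ := hyp
  exact Seregin2020.isSuitableWeakSolutionInBall_one hsw hA hG hE hq

/-- The weak spatial gradient `G = ∇v` on `Q = 𝒞 × ]-1,0[` restricts to the unit parabolic ball
`Q(0,1)` (`HasWeakSpatialGradientOn.mono`). [cite: Seregin2024AxisymTypeII, §1 p. 3 (the class ∇v ∈ L₂(Q))] -/
theorem hasWeakSpatialGradientOn_ball (hyp : Seregin2024ScenarioHypotheses v q G H W m s₁ l₁ c) :
    HasWeakSpatialGradientOn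
      (parabolicCylinderOpens 1 (0 : ℝ × EuclideanSpace ℝ (Fin 3))) v G :=
  hyp.2.2.1.mono parabolicCylinderOpens_one_le_parCylOpens

/-- (1.13): `1/2 ≤ m < 1`, in particular `0 < m < 1` — the range of
`Seregin2023.seregin2026_typeII_scenario_excluded.tendsto_cubic_seregin2025`.
[cite: Seregin2024AxisymTypeII, (1.13) (arXiv:2402.13229 p. 4)] -/
theorem m_mem_Ioo (hyp : Seregin2024ScenarioHypotheses v q G H W m s₁ l₁ c) :
    m ∈ Ioo (0 : ℝ) 1 := by
  obtain ⟨-, -, -, -, -, -, -, -, -, hm, hm1, -⟩ := hyp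
  exact ⟨by linarith, hm1⟩

/-- **(1.3) over the cylinders dominates [Seregin2026] (1.7) with `f(r) = r^{1-m}` over the balls.**
Under the standing hypotheses (of which only (1.3) is used): for `0 < r < 1`,
`A_f(v,r) + E_f(v,r) + D_f(q,r) ≤ 3c` with `f(r) = r^{1-m}`, since `f²/r = r^{-(2m-1)}`,
`f/r = r^{-m}`, `f²/r² = r^{-2m}` (`Seregin2023.rpow_one_sub_weights`), `B(r) ⊆ 𝒞(r)`,
`Q(r) ⊆ 𝒞(r) × ]-r²,0[` and the every-`t` bound of (1.3) bounds the essential supremum in `A_f`.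
Hence `HasWeightedEnergyBound (r ↦ r^{1-m}) M₁ v q G` with `M₁ = 3 c⁺`.
[cite: Seregin2024AxisymTypeII, (1.3) (arXiv:2402.13229 p. 2); Seregin2026, (1.7) (p. 4)] -/
theorem hasWeightedEnergyBound (hyp : Seregin2024ScenarioHypotheses v q G H W m s₁ l₁ c) :
    ∃ M₁ : ℝ≥0, Seregin2023.HasWeightedEnergyBound (fun r => r ^ (1 - m)) M₁ v q G := by
  obtain ⟨-, -, -, -, -, -, -, -, -, -, -, -, -, -, -, -, h13, -⟩ := hyp
  refine ⟨c.toNNReal + c.toNNReal + c.toNNReal, fun r hr => ?_⟩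
  have hr0 : 0 < r := hr.1
  obtain ⟨hAt, hDq, hEG⟩ := h13 r ⟨hr.1, hr.2.le⟩
  obtain ⟨wA, wE, wD⟩ := Seregin2023.rpow_one_sub_weights hr0 m
  have hsub : parabolicCylinder r (0 : ℝ × EuclideanSpace ℝ (Fin 3)) ⊆
      SereginSverak2009.parCyl 0 r := parabolicCylinder_subset_parCyl 0 r
  have hc : ((c.toNNReal + c.toNNReal + c.toNNReal : ℝ≥0) : ℝ≥0∞) =
      ENNReal.ofReal c + ENNReal.ofReal c + ENNReal.ofReal c := by
    rw [ENNReal.coe_add, ENNReal.coe_add]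
    rfl
  rw [hc]
  refine add_le_add (add_le_add ?_ ?_) ?_
  · -- `A_f(v,r) = ess sup_t r^{-(2m-1)} ∫_{B(r)} |v(t)|² ≤ c`
    unfold Seregin2023.weightedA
    rw [wA]
    refine essSup_le_of_ae_le _ ?_
    have ht0 : Ioo ((0 : ℝ × EuclideanSpace ℝ (Fin 3)).1 - r ^ 2)
        (0 : ℝ × EuclideanSpace ℝ (Fin 3)).1 = Ioo (-r ^ 2) 0 := by simp
    rw [ht0]
    filter_upwards [ae_restrict_mem measurableSet_Ioo] with t ht
    rw [Prod.snd_zero]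
    calc ENNReal.ofReal (r ^ (-(2 * m - 1))) * ∫⁻ x in ball 0 r, ‖v t x‖ₑ ^ 2
        ≤ ENNReal.ofReal (r ^ (-(2 * m - 1))) *
            ∫⁻ x in SereginSverak2009.spaceCyl 0 r, ‖v t x‖ₑ ^ 2 := by
          gcongr
          exact ball_subset_spaceCyl 0 r
      _ ≤ ENNReal.ofReal c := hAt t ht
  · -- `E_f(v,r) = r^{-m} ∫_{Q(r)} |∇v|² ≤ c`
    unfold Seregin2023.weightedE
    rw [wE]
    calc ENNReal.ofReal (r ^ (-m)) *
          ∫⁻ w in parabolicCylinder r (0 : ℝ × EuclideanSpace ℝ (Fin 3)),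
            ENNReal.ofReal (frobeniusNormSq (G w.1 w.2))
        ≤ ENNReal.ofReal (r ^ (-m)) *
            ∫⁻ w in SereginSverak2009.parCyl 0 r, ENNReal.ofReal (frobeniusNormSq (G w.1 w.2)) := by
          gcongr
      _ ≤ ENNReal.ofReal c := hEG
  · -- `D_f(q,r) = r^{-2m} ∫_{Q(r)} |q|^{3/2} ≤ c`
    unfold Seregin2023.weightedD
    rw [wD]
    calc ENNReal.ofReal (r ^ (-(2 * m))) *
          ∫⁻ w in parabolicCylinder r (0 : ℝ × EuclideanSpace ℝ (Fin 3)), ‖q w.1 w.2‖ₑ ^ (3 / 2 : ℝ)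
        ≤ ENNReal.ofReal (r ^ (-(2 * m))) *
            ∫⁻ w in SereginSverak2009.parCyl 0 r, ‖q w.1 w.2‖ₑ ^ (3 / 2 : ℝ) := by
          gcongr
      _ ≤ ENNReal.ofReal c := hDq

/-- **The Seregin-2024 scenario quantity tends to zero, given [Seregin2026] Thm 2.1.** Under the
standing hypotheses `Seregin2024ScenarioHypotheses v q G H W m s₁ l₁ c` (of which only the class,
(1.13) and (1.3) are used — no (2.3), no (1.5), (2.1), (2.2), no symmetry, no Type II hypothesis)
and the named fact `Seregin2023.seregin2026_typeII_scenario_excluded`: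
`M^{3,3}_{2,m₀}(v,r) → 0` as `r → 0⁺`, `m₀ = 2m/(3-m)`. Proof:
`Seregin2023.seregin2026_typeII_scenario_excluded.tendsto_cubic_seregin2025` in the ball class
(`isSuitableWeakSolutionInBall`, `hasWeakSpatialGradientOn_ball`, `m_mem_Ioo`,
`hasWeightedEnergyBound`), then `Seregin2023.morreyM_two_mul_three_three_eq` on `0 < r < 1`.
[cite: Seregin2024AxisymTypeII, Prop. 2.3 (arXiv:2402.13229 §2 p. 7); Seregin2026, Thm 2.1 (p. 5); Seregin2025TypeIIScenario, Thm 1.1 (p. 2)] -/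
theorem tendsto_morreyM_of_seregin2026 (h : Seregin2023.seregin2026_typeII_scenario_excluded)
    (hyp : Seregin2024ScenarioHypotheses v q G H W m s₁ l₁ c) :
    Tendsto
      (fun r : ℝ =>
        Seregin2023.morreyM (2 * (2 * m / (3 - m))) 3 3 (0 : ℝ × EuclideanSpace ℝ (Fin 3)) v r)
      (𝓝[>] 0) (𝓝 0) := by
  have hG := hyp.hasWeakSpatialGradientOn_ball
  have hlim := Seregin2023.seregin2026_typeII_scenario_excluded.tendsto_cubic_seregin2025 h
    hyp.isSuitableWeakSolutionInBall hG hyp.m_mem_Ioo hyp.hasWeightedEnergyBound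
  refine hlim.congr' ?_
  filter_upwards [Ioo_mem_nhdsGT (zero_lt_one' ℝ)] with r hr
  have hsub : parabolicCylinder r (0 : ℝ × EuclideanSpace ℝ (Fin 3)) ⊆
      (parabolicCylinderOpens 1 (0 : ℝ × EuclideanSpace ℝ (Fin 3)) :
        Set (ℝ × EuclideanSpace ℝ (Fin 3))) := by
    rw [coe_parabolicCylinderOpens]
    have h2 : r ^ 2 ≤ 1 ^ 2 := pow_le_pow_left₀ hr.1.le hr.2.le 2
    exact prod_mono (Ioo_subset_Ioo (by linarith) le_rfl) (ball_subset_ball hr.2.le)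
  have hmeas : AEStronglyMeasurable (uncurry v)
      (volume.restrict (parabolicCylinder r (0 : ℝ × EuclideanSpace ℝ (Fin 3)))) :=
    hG.locallyIntegrableOn.aestronglyMeasurable.mono_set hsub
  exact (Seregin2023.morreyM_two_mul_three_three_eq (2 * m / (3 - m)) hmeas).symm

end Seregin2024ScenarioHypotheses

/-! ### The two reductions -/

/-- **[Seregin2024AxisymTypeII] Prop. 2.3 follows from [Seregin2026] Thm 2.1**: the named fact
`seregin2024_axisym_typeII_scenario_excluded_Lq` is a consequence of the named fact
`Seregin2023.seregin2026_typeII_scenario_excluded` (the integrability hypothesis (2.3)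
`ess sup_t ∫_𝒞 |v|^q < ∞` is not needed). Consumers: cite `(h : Seregin2023.seregin2026_typeII_scenario_excluded)`
and this reduction rather than the Seregin-2024 fact.
[cite: Seregin2024AxisymTypeII, Prop. 2.3 (arXiv:2402.13229 §2 p. 7); Seregin2026, Thm 2.1 (p. 5)] -/
theorem seregin2024_axisym_typeII_scenario_excluded_Lq_of_seregin2026
    (h : Seregin2023.seregin2026_typeII_scenario_excluded) :
    seregin2024_axisym_typeII_scenario_excluded_Lq :=
  fun _v _q _G _H _W _m _s₁ _l₁ _c hyp _ => hyp.tendsto_morreyM_of_seregin2026 h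

/-- **[Seregin2024AxisymTypeII] Cor. 2.4 follows from [Seregin2026] Thm 2.1**: the named fact
`seregin2024_axisym_typeII_scenario_excluded_vorticity` is a consequence of the named fact
`Seregin2023.seregin2026_typeII_scenario_excluded` (the vorticity bound
`ess sup_t ∫_𝒞 |∇ × v|^{q₁} < ∞` is not needed).
[cite: Seregin2024AxisymTypeII, Cor. 2.4 (arXiv:2402.13229 §2 p. 7); Seregin2026, Thm 2.1 (p. 5)] -/
theorem seregin2024_axisym_typeII_scenario_excluded_vorticity_of_seregin2026
    (h : Seregin2023.seregin2026_typeII_scenario_excluded) :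
    seregin2024_axisym_typeII_scenario_excluded_vorticity :=
  fun _v _q _G _H _W _m _s₁ _l₁ _c hyp _ => hyp.tendsto_morreyM_of_seregin2026 h

end Literature.Analysis.FluidPDE

end
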